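import Literature.MathematicalPhysics.QuantumFieldTheory.Balaban1983to89.B9Eq310HessianOperator

/-!
# `Balaban1983to89.B9Eq328GaugeAction` — T. Bałaban, *Propagators for lattice gauge theories in a background field*, Commun. Math. Phys.
# **99** (1985) 389–434 [Balaban1985BackgroundPropagators] (3.28) p. 395 and the covariance of the derivative letters (3.3), (3.4), (3.8), (3.9),
# `D*D` (3.10)/(3.23) ON THE pub-balaban NE9 CHAIN'S CARRIERS: the gauge transformation `U → U^u` of a bond background of the periodic lattice,
# `R(u)` on the Hilbert fibre and on the weighted `L²` spaces of `𝔤ᶜ`-valued lattice functions, and `D_{U^u} R(u) = R(u) D_U` for every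
# derivative letter of the chain — pure conjugation algebra, every background, every gauge function, no smallness

statement-level skeleton of published theorems with citation tags; proofs where landed; nothing here is a claim about the Yang–Mills mass gap

PDF held: `paper:balaban1985-cmp99-background-propagators` (journal page = PDF page + 388), pp. 395–396 read by this seat (2026-08-22, text layer).

THE PRINT (verbatim, p. 395).  *«All the operators introduced above depend on a gauge field configuration U. Let us discuss how these operators
transform under gauge transformations of the configuration U. … if we make the transformations U → U^u, U′ → R(u)U′, (3.28) where
U^u(x, x′) = u(x)U(x, x′)u⁻¹(x′), (R(u)U′)(x, x′) = R(u(x))U′(x, x′), then … R(u)A is linear in A … We have a similar situation for the other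
operators. For the covariant Laplace operator (3.23) we have ⟨R(u)λ, Δ^η_{U^u}R(u)λ⟩ = ⟨λ, Δ^η_Uλ⟩, hence Δ^η_{U^u} = R(u)Δ^η_UR(u⁻¹). (3.31)»*;
p. 390: *«R(U)X = UXU⁻¹»*.

WHY THIS FILE (cell context).  The tree types (3.31)–(3.33) on the real `ℓ²` (3.25)-carriers `B9Thm311Lattice` (`B9Eq331LatticeCov`: *«the
vector-field operators of (3.30)/(3.34) (Δ^η(U), Δ_a, G on E₁) are not on these carriers and not treated»*) and (3.32) for the gauge-field
averages on `ℤ^d` (`B9Eq332FieldAvgCovariance`).  The pub-balaban NE9 chain lives on OTHER carriers (`B11Eq103H1Complex.SiteL2K/BondL2K ℂ d P c₀ W`,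
fibre `W` read in `𝔸 ⊇ 𝔤ᶜ` along `φ : W ≃ₗ[ℂ] 𝔸`, backgrounds `U : Bond d P → 𝔸ˣ`, transporters `B9Eq310HessianOperator.adTransportW φ U`).  This
file types (3.28) there and proves the covariance of every DERIVATIVE letter of the chain; (3.30), (3.32)–(3.33), (3.34) follow in sibling files.

WHAT IS DEFINED AND PROVED (sorry-free; no `Prop` placeholder; no inequality of the paper).
* §1 **`gaugeU g U`** — (3.28) on the bonds `⟨x, x+e_κ⟩` of `TSite d P` (background `U : Bond d P → G`, gauge function `g : TSite d P → G`);
  `gaugeU_inv_apply`, `gaugeU_one`, `gaugeU_mul` (an action), **`plaqHolU_gaugeU`** (`B9Eq310DeltaPrime`'s plaquette holonomy is CONJUGATED at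
  the plaquette corner — a group identity, no unitarity).
* §2 **`AdA u`** (`R(u)X = uXu⁻¹` as a `ℂ`-linear map of `𝔸`; `adTransport U b = AdA (U b)` by `rfl`), **`AdW φ u`** (`R(u)` READ ON THE HILBERT
  FIBRE along `φ`; `adTransportW φ U b = AdW φ (U b)` by `rfl`); multiplicativity, inverses, `tau_AdA_of_trace` (a tracial `τ` is `Ad`-invariant — the
  siblings' `hτ`), `star_AdA` (unitary `u`); **`adTransportW_gaugeU`** /
  `adTransportW_gaugeU_inv` (`R(U^u(b)) = R(u(b₋))R(U(b))R(u(b₊))⁻¹` and the inverse law for the adjoint transporters `R(U(b)⁻¹)`);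
  **`inner_AdW_AdW_of_compat`** — under the (18)-compatibility `⟨φ⁻¹X, φ⁻¹Y⟩ = τ(X*Y)` (`B9Eq310HessianOperator.inner_eq_sum_trace`), an
  `Ad`-invariant `τ` and a unitary `u`, `R(u)` IS AN ISOMETRY of the fibre (the displayed hypothesis `hAd` below is then a theorem).
* §3 **`gaugeW φ u`** — `R(u)` on a weighted `L²` carrier `WL2 ℂ w W` (pointwise `AdW φ (u i)`, `u : ι → 𝔸ˣ`; sites `u = g`, bonds/plaquettes
  `u = g ∘ base point`); invertibility, `gaugeW_surjective`, **`inner_gaugeW`** / `norm_gaugeW` (an isometry, given `hAd`), `toAlg_gaugeW`.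
* §4 [folklore] pointwise conjugation lemmas for the four lattice derivatives with ABSTRACT fibre actions, then **`covDerivL2K_gaugeU`** ((3.3)
  `D_{U^u}R(u) = R(u)D_U`), **`covDivL2K_gaugeU`** ((3.8)), **`covCurlL2K_gaugeU`** ((3.4)), **`covCoCurlL2K_gaugeU`** ((3.9)), **`principalOpK_gaugeU`**
  (`D*D` of (3.10)), **`covLaplaceSiteK_gaugeU`** ((3.23)/(3.31) `Δ^η_{U^u}R(u) = R(u)Δ^η_U`) — EVERY background, EVERY `𝔸ˣ`-valued gauge
  function, NO hypothesis.
MODEL / DECLARED READINGS.  (M1) the chain's encodings verbatim; the gauge group acts on the fibre through `R(u) = φ⁻¹ ∘ Ad(u) ∘ φ`.  (M2) no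
hypothesis of the paper except, for the isometry statements, the displayed `hAd` (unitarity of `R(u(x))` in the norming (18)) — derived in §2
from the compatibility of `τ` with the fibre's scalar product.  (M3) NOT HERE: (3.30) (curvature part), (3.32)–(3.34), any bound.
HONEST SCOPE.  [folklore] finite-dimensional conjugation algebra on the cell's own typed carriers realising a printed transformation law; no
estimate of the paper; NOT summit progress (cell pub-balaban: NE9 NOT PRINTED / NOT PROVED; «NE9 ⇐ the named binders»; spine PROVED 0/9; HONEST
DEPENDENCY: continuum YM on T⁴ ⇐ BetaPertH ∧ nine spine estimates (0/9 proved); BetaPertH ⇐ (D1) ∧ (D4) ∧ CAP+tail; G-an2-4 gates asym, D1 and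
NE2/3/4).  Unit `b2b-balaban-t4-ne9-formalise-leaf-03` (NE9 crux-team leaf prover, gen 60), INTENT I-ne9leaf03-g60-1 file (G0); NEW file importing
`B9Eq310HessianOperator` only; modifies nothing.  Net new unproved facts: 0.
-/

noncomputable section

open scoped InnerProductSpace ComplexConjugate BigOperators

namespace Literature.MathematicalPhysics.QuantumFieldTheory.Balaban1983to89.B9Eq328GaugeAction

open B9SectCLatticeCarrier (Bond DirPair bpos btgt shift unshift)
open B4Sect5Torus (TSite)
open B9Eq311L2Pairing (WL2)
open B9Eq33CovDerivVector (adTransport covDeriv covDiv covDeriv_apply covDiv_apply)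
open B9Eq34CovCurlVector (covCurl covCoCurl covLapPrincipal covCurl_apply_coord covCoCurl_apply shift_comm)
open B9Eq310DeltaPrime (plaqHolU)
open B11Eq103H1Complex (SiteL2K BondL2K covDerivL2K covDivL2K covLaplaceSiteK equiv_covDerivL2K equiv_covDivL2K funEquiv_apply)
open B9Eq310HessianOperator (adTransportW PlaqL2K covCurlL2K covCoCurlL2K principalOpK equiv_covCurlL2K equiv_covCoCurlL2K toAlg)

variable {d : ℕ} {Pd : Fin d → ℕ}

/-! ## §1 (3.28): the gauge transformation `U → U^u` of a bond background of the periodic lattice -/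

section GaugeU

variable {G : Type*} [Group G]

/-- **(3.28) `U^u(x, x′) = u(x)U(x, x′)u⁻¹(x′)`** for the positively oriented bonds `⟨x, x+e_κ⟩ = (x, κ)` of the periodic lattice `TSite d P`:
the gauge function `g` acts at the two ends of the bond. [cite: Balaban1985BackgroundPropagators, (3.28) p.395] -/
def gaugeU (g : TSite d Pd → G) (U : Bond d Pd → G) : Bond d Pd → G := fun b => g (bpos b) * U b * (g (btgt b))⁻¹

/-- Unfolding (3.28). [cite: Balaban1985BackgroundPropagators, (3.28) p.395] -/
theorem gaugeU_apply (g : TSite d Pd → G) (U : Bond d Pd → G) (b : Bond d Pd) : gaugeU g U b = g (bpos b) * U b * (g (btgt b))⁻¹ := rfl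
/-- (3.28) at the bond `(x, κ) = ⟨x, x+e_κ⟩`. [cite: Balaban1985BackgroundPropagators, (3.28) p.395] -/
theorem gaugeU_apply_dir (g : TSite d Pd → G) (U : Bond d Pd → G) (x : TSite d Pd) (κ : Fin d) :
    gaugeU g U (x, κ) = g x * U (x, κ) * (g (shift κ x))⁻¹ := rfl

/-- The inverse bond variable of `U^u`: `U^u(b)⁻¹ = u(b₊)U(b)⁻¹u(b₋)⁻¹` ((3.5) `U(x′, x) = U(x, x′)⁻¹` transforms by (3.28) read backwards).
[cite: Balaban1985BackgroundPropagators, (3.28) p.395, (3.5) p.391] -/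
theorem gaugeU_inv_apply (g : TSite d Pd → G) (U : Bond d Pd → G) (b : Bond d Pd) :
    (gaugeU g U b)⁻¹ = g (btgt b) * (U b)⁻¹ * (g (bpos b))⁻¹ := by
  rw [gaugeU_apply, mul_inv_rev, mul_inv_rev, inv_inv, mul_assoc]

/-- The trivial gauge function acts trivially. [cite: Balaban1985BackgroundPropagators, (3.28) p.395] -/
theorem gaugeU_one (U : Bond d Pd → G) : gaugeU (1 : TSite d Pd → G) U = U := by
  funext b; simp [gaugeU_apply]

/-- (3.28) is an ACTION: `U^{gh} = (U^h)^g`. [cite: Balaban1985BackgroundPropagators, (3.28) p.395] -/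
theorem gaugeU_mul (g h : TSite d Pd → G) (U : Bond d Pd → G) : gaugeU (g * h) U = gaugeU g (gaugeU h U) := by
  funext b; simp only [gaugeU_apply, Pi.mul_apply, mul_inv_rev, mul_assoc]

/-- `(U^g)^{g⁻¹} = U`. [cite: Balaban1985BackgroundPropagators, (3.28) p.395] -/
theorem gaugeU_inv_gaugeU (g : TSite d Pd → G) (U : Bond d Pd → G) : gaugeU g⁻¹ (gaugeU g U) = U := by
  rw [← gaugeU_mul, inv_mul_cancel, gaugeU_one]

end GaugeU

section Holonomy

variable {𝔸 : Type*} [Ring 𝔸]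

/-- **The plaquette holonomy `U(∂p)` of `B9Eq310DeltaPrime` is CONJUGATED by `u` at the plaquette corner**: `U^u(∂p) = u(x)U(∂p)u(x)⁻¹` for
`p = p_{μν}(x)` — a group identity (the two paths `x+e_μ+e_ν = x+e_ν+e_μ` around the plaquette meet). [cite: Balaban1985BackgroundPropagators, (3.28)–(3.29) p.395, (3.1) p.390] -/
theorem plaqHolU_gaugeU (g : TSite d Pd → 𝔸ˣ) (U : Bond d Pd → 𝔸ˣ) (p : B9SectCLatticeCarrier.Plaq d Pd) :
    plaqHolU (gaugeU g U) p = g p.1 * plaqHolU U p * (g p.1)⁻¹ := by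
  obtain ⟨x, q⟩ := p
  simp only [plaqHolU, gaugeU_apply_dir, shift_comm q.1.2 q.1.1 x]
  group

end Holonomy

/-! ## §2 `R(u)X = uXu⁻¹` on the algebra and on the Hilbert fibre -/

section Ad

variable {𝔸 : Type*} [Ring 𝔸] [Algebra ℂ 𝔸]

/-- **`R(u)X = uXu⁻¹`** (p. 390) as a `ℂ`-linear map of the algebra `𝔸 ⊇ 𝔤ᶜ`, for a unit `u` — the bond-free form of
`B9Eq33CovDerivVector.adTransport`. [cite: Balaban1985BackgroundPropagators, p.390, (3.28) p.395] -/
def AdA (u : 𝔸ˣ) : 𝔸 →ₗ[ℂ] 𝔸 := (LinearMap.mulLeft ℂ (u : 𝔸)).comp (LinearMap.mulRight ℂ ((u⁻¹ : 𝔸ˣ) : 𝔸))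

/-- Unfolding: `R(u)X = u·X·u⁻¹`. [cite: Balaban1985BackgroundPropagators, p.390] -/
theorem AdA_apply (u : 𝔸ˣ) (X : 𝔸) : AdA u X = (u : 𝔸) * X * ((u⁻¹ : 𝔸ˣ) : 𝔸) := by
  simp only [AdA, LinearMap.comp_apply, LinearMap.mulRight_apply, LinearMap.mulLeft_apply, mul_assoc]

/-- The chain's bond transporter IS `R(U(b))`: `adTransport U b = AdA (U b)`. [cite: Balaban1985BackgroundPropagators, p.390] -/
theorem adTransport_eq_AdA (U : Bond d Pd → 𝔸ˣ) (b : Bond d Pd) : adTransport (𝕜 := ℂ) U b = AdA (U b) := rfl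

/-- `R(uv) = R(u)R(v)`. [cite: Balaban1985BackgroundPropagators, p.390] -/
theorem AdA_mul_apply (u v : 𝔸ˣ) (X : 𝔸) : AdA (u * v) X = AdA u (AdA v X) := by
  simp only [AdA_apply, Units.val_mul, mul_inv_rev, mul_assoc]

/-- `R(u⁻¹)R(u) = 1`. [cite: Balaban1985BackgroundPropagators, p.390] -/
@[simp] theorem AdA_inv_apply (u : 𝔸ˣ) (X : 𝔸) : AdA u⁻¹ (AdA u X) = X := by
  rw [← AdA_mul_apply, inv_mul_cancel, AdA_apply, Units.val_one, inv_one, Units.val_one, one_mul, mul_one]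
/-- `R(u)R(u⁻¹) = 1`. [cite: Balaban1985BackgroundPropagators, p.390] -/
@[simp] theorem AdA_apply_inv (u : 𝔸ˣ) (X : 𝔸) : AdA u (AdA u⁻¹ X) = X := by
  rw [← AdA_mul_apply, mul_inv_cancel, AdA_apply, Units.val_one, inv_one, Units.val_one, one_mul, mul_one]

/-- `R(u)` is multiplicative: `R(u)(XY) = R(u)X·R(u)Y`. [cite: Balaban1985BackgroundPropagators, p.390] -/
theorem AdA_map_mul (u : 𝔸ˣ) (X Y : 𝔸) : AdA u (X * Y) = AdA u X * AdA u Y := by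
  simp only [AdA_apply, mul_assoc, Units.inv_mul_cancel_left]
/-- `R(u)1 = 1`. [cite: Balaban1985BackgroundPropagators, p.390] -/
@[simp] theorem AdA_one_right (u : 𝔸ˣ) : AdA u (1 : 𝔸) = 1 := by
  rw [AdA_apply, mul_one, Units.mul_inv]

/-- A TRACIAL `τ` (`τ(XY) = τ(YX)`, print's `tr`) is `Ad`-invariant: `τ(uXu⁻¹) = τ(X)` — the displayed `hτ` of the sibling files.
[cite: Balaban1985BackgroundPropagators, p.391] -/
theorem tau_AdA_of_trace (τ : 𝔸 →ₗ[ℂ] ℂ) (htr : ∀ X Y : 𝔸, τ (X * Y) = τ (Y * X)) (u : 𝔸ˣ) (X : 𝔸) : τ (AdA u X) = τ X := by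
  rw [AdA_apply, htr, ← mul_assoc, Units.inv_mul, one_mul]

/-- For a UNITARY `u` (`u* = u⁻¹`) `R(u)` commutes with the adjoint: `(R(u)X)* = R(u)X*`. [cite: Balaban1985BackgroundPropagators, p.391] -/
theorem star_AdA [StarRing 𝔸] {u : 𝔸ˣ} (hu : star (u : 𝔸) = ((u⁻¹ : 𝔸ˣ) : 𝔸)) (X : 𝔸) : star (AdA u X) = AdA u (star X) := by
  have hu' : star ((u⁻¹ : 𝔸ˣ) : 𝔸) = (u : 𝔸) := by rw [← hu, star_star]
  rw [AdA_apply, AdA_apply, star_mul, star_mul, hu, hu', mul_assoc]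

variable {W : Type*} [NormedAddCommGroup W] [InnerProductSpace ℂ W] (φ : W ≃ₗ[ℂ] 𝔸)

/-- **`R(u)` READ ON THE HILBERT FIBRE** along `φ : W ≃ 𝔸`: `φ⁻¹ ∘ R(u) ∘ φ` — the bond-free form of `B9Eq310HessianOperator.adTransportW`.
[cite: Balaban1985BackgroundPropagators, p.390, (3.28) p.395] -/
def AdW (u : 𝔸ˣ) : W →ₗ[ℂ] W := φ.symm.toLinearMap ∘ₗ AdA u ∘ₗ φ.toLinearMap

/-- Unfolding: `R(u)w = φ⁻¹(u·φw·u⁻¹)`. [cite: Balaban1985BackgroundPropagators, p.390] -/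
theorem AdW_apply (u : 𝔸ˣ) (w : W) : AdW φ u w = φ.symm ((u : 𝔸) * φ w * ((u⁻¹ : 𝔸ˣ) : 𝔸)) := by
  simp only [AdW, LinearMap.comp_apply, LinearEquiv.coe_coe, AdA_apply]

/-- Read back in the algebra: `φ(R(u)w) = R(u)(φw)`. [cite: Balaban1985BackgroundPropagators, p.390] -/
@[simp] theorem apply_AdW (u : 𝔸ˣ) (w : W) : φ (AdW φ u w) = AdA u (φ w) := by
  simp only [AdW, LinearMap.comp_apply, LinearEquiv.coe_coe, LinearEquiv.apply_symm_apply]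

/-- The chain's transporter on the fibre IS `R(U(b))` read on the fibre: `adTransportW φ U b = AdW φ (U b)`. [cite: Balaban1985BackgroundPropagators, p.390] -/
theorem adTransportW_eq_AdW (U : Bond d Pd → 𝔸ˣ) (b : Bond d Pd) : adTransportW φ U b = AdW φ (U b) := rfl

/-- `R(uv) = R(u)R(v)` on the fibre. [cite: Balaban1985BackgroundPropagators, p.390] -/
theorem AdW_mul_apply (u v : 𝔸ˣ) (w : W) : AdW φ (u * v) w = AdW φ u (AdW φ v w) := by
  simp only [AdW, LinearMap.comp_apply, LinearEquiv.coe_coe, LinearEquiv.apply_symm_apply, AdA_mul_apply]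

/-- `R(u⁻¹)R(u) = 1` on the fibre. [cite: Balaban1985BackgroundPropagators, p.390] -/
@[simp] theorem AdW_inv_apply (u : 𝔸ˣ) (w : W) : AdW φ u⁻¹ (AdW φ u w) = w := by
  rw [← AdW_mul_apply, inv_mul_cancel, AdW_apply, Units.val_one, inv_one, Units.val_one, one_mul, mul_one, LinearEquiv.symm_apply_apply]
/-- `R(u)R(u⁻¹) = 1` on the fibre. [cite: Balaban1985BackgroundPropagators, p.390] -/
@[simp] theorem AdW_apply_inv (u : 𝔸ˣ) (w : W) : AdW φ u (AdW φ u⁻¹ w) = w := by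
  rw [← AdW_mul_apply, mul_inv_cancel, AdW_apply, Units.val_one, inv_one, Units.val_one, one_mul, mul_one, LinearEquiv.symm_apply_apply]

/-- **THE TRANSPORTERS OF `U^u`**: `R(U^u(b)) = R(u(b₋)) R(U(b)) R(u(b₊))⁻¹` on the fibre (print: *«R(U^u(Γ_{y,x})) = R(u(y))R(U(Γ_{y,x}))R(u⁻¹(x))»*
for the one-bond contour). [cite: Balaban1985BackgroundPropagators, (3.28) p.395, (3.32) p.395] -/
theorem adTransportW_gaugeU (g : TSite d Pd → 𝔸ˣ) (U : Bond d Pd → 𝔸ˣ) (b : Bond d Pd) (w : W) :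
    adTransportW φ (gaugeU g U) b w = AdW φ (g (bpos b)) (adTransportW φ U b (AdW φ (g (btgt b))⁻¹ w)) := by
  rw [adTransportW_eq_AdW, adTransportW_eq_AdW, gaugeU_apply, AdW_mul_apply, AdW_mul_apply]

/-- The ADJOINT transporters `R(U(b)⁻¹)` of the chain transform by the inverse law: `R(U^u(b)⁻¹) = R(u(b₊)) R(U(b)⁻¹) R(u(b₋))⁻¹`.
[cite: Balaban1985BackgroundPropagators, (3.28) p.395, (3.8) p.392] -/
theorem adTransportW_gaugeU_inv (g : TSite d Pd → 𝔸ˣ) (U : Bond d Pd → 𝔸ˣ) (b : Bond d Pd) (w : W) :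
    adTransportW φ (fun b => (gaugeU g U b)⁻¹) b w = AdW φ (g (btgt b)) (adTransportW φ (fun b => (U b)⁻¹) b (AdW φ (g (bpos b))⁻¹ w)) := by
  rw [adTransportW_eq_AdW, adTransportW_eq_AdW, gaugeU_inv_apply, AdW_mul_apply, AdW_mul_apply]

/-- **`R(u)` IS AN ISOMETRY OF THE FIBRE in the norming (18)** when the fibre's scalar product is `⟨φ⁻¹X, φ⁻¹Y⟩ = τ(X*Y)` (the compatibility of
`B9Eq310HessianOperator.inner_eq_sum_trace`), `τ` is `Ad`-invariant along `u` (trace cyclicity) and `u` is unitary (`u* = u⁻¹`): the displayed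
hypothesis `hAd` of §3–§4 and of the sibling files DERIVED. [cite: Balaban1985Averaging, (18) p.21; Balaban1985BackgroundPropagators, (3.30) p.395] -/
theorem inner_AdW_AdW_of_compat [StarRing 𝔸] (τ : 𝔸 →ₗ[ℂ] ℂ) (hτW : ∀ X Y : 𝔸, ⟪φ.symm X, φ.symm Y⟫_ℂ = τ (star X * Y)) {u : 𝔸ˣ}
    (hτ : ∀ X : 𝔸, τ (AdA u X) = τ X) (hu : star (u : 𝔸) = ((u⁻¹ : 𝔸ˣ) : 𝔸)) (v w : W) : ⟪AdW φ u v, AdW φ u w⟫_ℂ = ⟪v, w⟫_ℂ := by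
  have h0 : ⟪v, w⟫_ℂ = ⟪φ.symm (φ v), φ.symm (φ w)⟫_ℂ := by rw [LinearEquiv.symm_apply_apply, LinearEquiv.symm_apply_apply]
  rw [AdW_apply, AdW_apply, hτW, h0, hτW, ← AdA_apply, ← AdA_apply, star_AdA hu, ← AdA_map_mul, hτ]

end Ad

/-! ## §3 `R(u)` on the weighted `L²` carriers of `W`-valued lattice functions -/

section Carrier

variable {𝔸 : Type*} [Ring 𝔸] [Algebra ℂ 𝔸] {W : Type*} [NormedAddCommGroup W] [InnerProductSpace ℂ W] (φ : W ≃ₗ[ℂ] 𝔸)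
  {ι : Type*} {w : ι → ℝ}

/-- **`R(u)` ON A WEIGHTED `L²` CARRIER** `WL2 ℂ w W` of `W`-valued functions on an index set `ι` (sites; bonds or plaquettes through their base
point): `(R(u)f)(i) = R(u(i))f(i)` pointwise, read on the fibre along `φ`. [cite: Balaban1985BackgroundPropagators, (3.28) p.395, (3.30)–(3.31) p.395] -/
def gaugeW (u : ι → 𝔸ˣ) : WL2 ℂ w W →ₗ[ℂ] WL2 ℂ w W :=
  (WL2.linearEquiv ℂ ℂ w).symm.toLinearMap ∘ₗ (LinearMap.pi fun i => AdW φ (u i) ∘ₗ LinearMap.proj i) ∘ₗ (WL2.linearEquiv ℂ ℂ w).toLinearMap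

/-- Pointwise: `(R(u)f)(i) = R(u(i))f(i)`. [cite: Balaban1985BackgroundPropagators, (3.28) p.395] -/
@[simp] theorem equiv_gaugeW (u : ι → 𝔸ˣ) (f : WL2 ℂ w W) (i : ι) : WL2.equiv ℂ w W (gaugeW φ u f) i = AdW φ (u i) (WL2.equiv ℂ w W f i) := rfl

/-- The same as an equality of functions. [cite: Balaban1985BackgroundPropagators, (3.28) p.395] -/
theorem equiv_gaugeW_eq (u : ι → 𝔸ˣ) (f : WL2 ℂ w W) : WL2.equiv ℂ w W (gaugeW φ u f) = fun i => AdW φ (u i) (WL2.equiv ℂ w W f i) := rfl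
/-- `R(u⁻¹)R(u) = 1` on the carrier. [cite: Balaban1985BackgroundPropagators, (3.28) p.395] -/
@[simp] theorem gaugeW_inv_apply (u : ι → 𝔸ˣ) (f : WL2 ℂ w W) : gaugeW φ u⁻¹ (gaugeW φ u f) = f := by
  apply (WL2.equiv ℂ w W).injective
  funext i
  rw [equiv_gaugeW, equiv_gaugeW, Pi.inv_apply, AdW_inv_apply]
/-- `R(u)R(u⁻¹) = 1` on the carrier. [cite: Balaban1985BackgroundPropagators, (3.28) p.395] -/
@[simp] theorem gaugeW_apply_inv (u : ι → 𝔸ˣ) (f : WL2 ℂ w W) : gaugeW φ u (gaugeW φ u⁻¹ f) = f := by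
  apply (WL2.equiv ℂ w W).injective
  funext i
  rw [equiv_gaugeW, equiv_gaugeW, Pi.inv_apply, AdW_apply_inv]

/-- `R(u)` is injective. [cite: Balaban1985BackgroundPropagators, (3.28) p.395] -/
theorem gaugeW_injective (u : ι → 𝔸ˣ) : Function.Injective (gaugeW φ u (w := w)) := fun f f' h => by
  rw [← gaugeW_inv_apply φ u f, h, gaugeW_inv_apply]
/-- `R(u)f = 0 ↔ f = 0`. [cite: Balaban1985BackgroundPropagators, (3.28) p.395] -/
theorem gaugeW_eq_zero_iff (u : ι → 𝔸ˣ) (f : WL2 ℂ w W) : gaugeW φ u f = 0 ↔ f = 0 :=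
  ⟨fun h => gaugeW_injective φ u (by rw [h, map_zero]), fun h => by rw [h, map_zero]⟩

/-- A function of the carrier READ IN THE ALGEBRA (`B9Eq310HessianOperator.toAlg`) transforms by `R(u(i))` pointwise.
[cite: Balaban1985BackgroundPropagators, (3.28) p.395] -/
theorem toAlg_gaugeW {c₀ : ℝ} (u : Bond d Pd → 𝔸ˣ) (f : BondL2K ℂ d Pd c₀ W) : toAlg φ (gaugeW φ u f) = fun b => AdA (u b) (toAlg φ f b) := by
  funext b
  show φ (WL2.equiv ℂ _ W (gaugeW φ u f) b) = AdA (u b) (φ (WL2.equiv ℂ _ W f b))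
  rw [equiv_gaugeW, apply_AdW]

variable [Fintype ι] [Fact (∀ i, 0 < w i)]

/-- **`R(u)` IS AN ISOMETRY OF THE WEIGHTED `L²` CARRIER** given the fibrewise isometry `hAd` (unitarity of `R(u(i))` in the norming (18)): print's
`⟨R(u)A, R(u)B⟩ = ⟨A, B⟩`, the mechanism of (3.30)–(3.31). [cite: Balaban1985BackgroundPropagators, (3.30)–(3.31) p.395] -/
theorem inner_gaugeW (u : ι → 𝔸ˣ) (hAd : ∀ (i : ι) (v v' : W), ⟪AdW φ (u i) v, AdW φ (u i) v'⟫_ℂ = ⟪v, v'⟫_ℂ) (f f' : WL2 ℂ w W) :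
    ⟪gaugeW φ u f, gaugeW φ u f'⟫_ℂ = ⟪f, f'⟫_ℂ := by
  rw [WL2.inner_def, WL2.inner_def]
  exact Finset.sum_congr rfl fun i _ => by rw [equiv_gaugeW, equiv_gaugeW, hAd]

/-- `‖R(u)f‖ = ‖f‖`. [cite: Balaban1985BackgroundPropagators, (3.30)–(3.31) p.395] -/
theorem norm_gaugeW (u : ι → 𝔸ˣ) (hAd : ∀ (i : ι) (v v' : W), ⟪AdW φ (u i) v, AdW φ (u i) v'⟫_ℂ = ⟪v, v'⟫_ℂ) (f : WL2 ℂ w W) :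
    ‖gaugeW φ u f‖ = ‖f‖ := by
  rw [@norm_eq_sqrt_re_inner ℂ, @norm_eq_sqrt_re_inner ℂ, inner_gaugeW φ u hAd]

/-- The adjoint-pair form: `⟨R(u)f, f′⟩ = ⟨f, R(u⁻¹)f′⟩` (so `R(u)† = R(u⁻¹) = R(u)⁻¹`). [cite: Balaban1985BackgroundPropagators, (3.30)–(3.31) p.395] -/
theorem inner_gaugeW_left (u : ι → 𝔸ˣ) (hAd : ∀ (i : ι) (v v' : W), ⟪AdW φ (u i) v, AdW φ (u i) v'⟫_ℂ = ⟪v, v'⟫_ℂ) (f f' : WL2 ℂ w W) :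
    ⟪gaugeW φ u f, f'⟫_ℂ = ⟪f, gaugeW φ u⁻¹ f'⟫_ℂ := by
  conv_lhs => rw [← gaugeW_apply_inv φ u f']
  exact inner_gaugeW φ u hAd f _

end Carrier

/-! ## §4 The derivative letters are covariant: `D_{U^u}R(u) = R(u)D_U` for (3.3), (3.4), (3.8), (3.9), `D*D`, `D*_U D_U` -/

section Pointwise

variable {V : Type*} [AddCommGroup V] [Module ℂ V]

/-- [folklore] (3.3) under a fibre action `A` (left inverse `B`), `R′(b) = A(b₋)R(b)B(b₊)`: `D_{R′}(Af) = A(b₋)D_R f`. [cite: Balaban1985BackgroundPropagators, (3.3) p.390] -/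
theorem covDeriv_conj (c : ℂ) (R R' : Bond d Pd → V →ₗ[ℂ] V) (A B : TSite d Pd → V →ₗ[ℂ] V) (hBA : ∀ x v, B x (A x v) = v)
    (hR' : ∀ b v, R' b v = A (bpos b) (R b (B (btgt b) v))) (f : TSite d Pd → V) (b : Bond d Pd) :
    covDeriv c R' (fun x => A x (f x)) b = A (bpos b) (covDeriv c R f b) := by
  rw [covDeriv_apply, covDeriv_apply, hR', hBA, map_smul, map_sub]

/-- [folklore] (3.8) likewise: `S′(b) = A(b₊)S(b)B(b₋)` gives `D*_{S′}(AX) = A(y)D*_S X`. [cite: Balaban1985BackgroundPropagators, (3.8) p.392] -/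
theorem covDiv_conj (c : ℂ) (S S' : Bond d Pd → V →ₗ[ℂ] V) (A B : TSite d Pd → V →ₗ[ℂ] V) (hBA : ∀ x v, B x (A x v) = v)
    (hS' : ∀ b v, S' b v = A (btgt b) (S b (B (bpos b) v))) (X : Bond d Pd → V) (y : TSite d Pd) :
    covDiv c S' (fun b => A (bpos b) (X b)) y = A y (covDiv c S X y) := by
  rw [covDiv_apply, covDiv_apply, map_smul, map_sum]
  congr 1
  refine Finset.sum_congr rfl fun μ _ => ?_
  rw [map_sub, hS']
  simp only [bpos, btgt, B9SectCLatticeCarrier.shift_unshift, hBA]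

/-- [folklore] (3.4) likewise: `D_{R′}(A X)(p) = A(x)·(D_R X)(p)` for `p = p_{μν}(x)`. [cite: Balaban1985BackgroundPropagators, (3.4) p.391, (3.30) p.395] -/
theorem covCurl_conj (c : ℂ) (R R' : Bond d Pd → V →ₗ[ℂ] V) (A B : TSite d Pd → V →ₗ[ℂ] V) (hBA : ∀ x v, B x (A x v) = v)
    (hR' : ∀ b v, R' b v = A (bpos b) (R b (B (btgt b) v))) (X : Bond d Pd → V) (p : B9SectCLatticeCarrier.Plaq d Pd) :
    covCurl c R' (fun b => A (bpos b) (X b)) p = A p.1 (covCurl c R X p) := by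
  obtain ⟨x, q⟩ := p
  rw [covCurl_apply_coord, covCurl_apply_coord, hR', hR']
  simp only [bpos, btgt, hBA, map_sub, map_smul]

/-- [folklore] (3.9) likewise: `D*_{S′}(A F)(y, κ) = A(y)·(D*_S F)(y, κ)`. [cite: Balaban1985BackgroundPropagators, (3.9) p.392, (3.30) p.395] -/
theorem covCoCurl_conj (c : ℂ) (S S' : Bond d Pd → V →ₗ[ℂ] V) (A B : TSite d Pd → V →ₗ[ℂ] V) (hBA : ∀ x v, B x (A x v) = v)
    (hS' : ∀ b v, S' b v = A (btgt b) (S b (B (bpos b) v))) (F : B9SectCLatticeCarrier.Plaq d Pd → V) (b : Bond d Pd) :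
    covCoCurl c S' (fun p => A p.1 (F p)) b = A (bpos b) (covCoCurl c S F b) := by
  obtain ⟨y, κ⟩ := b
  rw [covCoCurl_apply, covCoCurl_apply, map_smul, map_sub, map_sum, map_sum]
  congr 1
  congr 1
  · refine Finset.sum_congr rfl fun q _ => ?_
    rw [map_sub, hS']
    simp only [bpos, btgt, B9SectCLatticeCarrier.shift_unshift, hBA]
  · refine Finset.sum_congr rfl fun q _ => ?_
    rw [map_sub, hS']
    simp only [bpos, btgt, B9SectCLatticeCarrier.shift_unshift, hBA]

end Pointwise

section Letters

variable {𝔸 : Type*} [Ring 𝔸] [Algebra ℂ 𝔸] {W : Type*} [NormedAddCommGroup W] [InnerProductSpace ℂ W] (φ : W ≃ₗ[ℂ] 𝔸)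
  {c₀ : ℝ} [Fact (0 < c₀)] (c : ℂ) (g : TSite d Pd → 𝔸ˣ) (U : Bond d Pd → 𝔸ˣ)

/-- **(3.3) IS COVARIANT: `D_{U^u} R(u) = R(u) D_U`** on the `W`-valued gauge parameters of the chain (`R(u)` acting at the base point `b₋` on bond
functions). [cite: Balaban1985BackgroundPropagators, (3.3) p.390, (3.31) p.395] -/
theorem covDerivL2K_gaugeU (f : SiteL2K ℂ d Pd c₀ W) :
    covDerivL2K ℂ c₀ c (adTransportW φ (gaugeU g U)) (gaugeW φ g f) =
      gaugeW φ (fun b : Bond d Pd => g (bpos b)) (covDerivL2K ℂ c₀ c (adTransportW φ U) f) := by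
  apply (WL2.equiv ℂ (fun _ : Bond d Pd => c₀) W).injective
  funext b
  rw [equiv_covDerivL2K, equiv_gaugeW_eq, equiv_gaugeW, equiv_covDerivL2K]
  exact covDeriv_conj c _ _ (fun x => AdW φ (g x)) (fun x => AdW φ (g x)⁻¹) (fun x v => AdW_inv_apply φ (g x) v)
    (fun b v => adTransportW_gaugeU φ g U b v) _ b

/-- **(3.8) IS COVARIANT: `D*_{U^u} R(u) = R(u) D*_U`** (the chain's `D*` carries the adjoint transporters `R(U(b)⁻¹)`).
[cite: Balaban1985BackgroundPropagators, (3.8) p.392, (3.31) p.395] -/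
theorem covDivL2K_gaugeU (X : BondL2K ℂ d Pd c₀ W) :
    covDivL2K ℂ c₀ c (adTransportW φ fun b => (gaugeU g U b)⁻¹) (gaugeW φ (fun b : Bond d Pd => g (bpos b)) X) =
      gaugeW φ g (covDivL2K ℂ c₀ c (adTransportW φ fun b => (U b)⁻¹) X) := by
  apply (WL2.equiv ℂ (fun _ : TSite d Pd => c₀) W).injective
  funext y
  rw [equiv_covDivL2K, equiv_gaugeW_eq, equiv_gaugeW, equiv_covDivL2K]
  exact covDiv_conj c _ _ (fun x => AdW φ (g x)) (fun x => AdW φ (g x)⁻¹) (fun x v => AdW_inv_apply φ (g x) v)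
    (fun b v => adTransportW_gaugeU_inv φ g U b v) _ y

/-- **(3.4) IS COVARIANT: `D_{U^u} R(u) = R(u) D_U`** on bond functions, `R(u)` acting at the plaquette corner on plaquette functions.
[cite: Balaban1985BackgroundPropagators, (3.4) p.391, (3.30) p.395] -/
theorem covCurlL2K_gaugeU (X : BondL2K ℂ d Pd c₀ W) :
    covCurlL2K ℂ c₀ c (adTransportW φ (gaugeU g U)) (gaugeW φ (fun b : Bond d Pd => g (bpos b)) X) =
      gaugeW φ (fun p : B9SectCLatticeCarrier.Plaq d Pd => g p.1) (covCurlL2K ℂ c₀ c (adTransportW φ U) X) := by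
  apply (WL2.equiv ℂ (fun _ : B9SectCLatticeCarrier.Plaq d Pd => c₀) W).injective
  funext p
  rw [equiv_covCurlL2K, equiv_gaugeW_eq, equiv_gaugeW, equiv_covCurlL2K]
  exact covCurl_conj c _ _ (fun x => AdW φ (g x)) (fun x => AdW φ (g x)⁻¹) (fun x v => AdW_inv_apply φ (g x) v)
    (fun b v => adTransportW_gaugeU φ g U b v) _ p

/-- **(3.9) IS COVARIANT: `D*_{U^u} R(u) = R(u) D*_U`** from plaquette to bond functions. [cite: Balaban1985BackgroundPropagators, (3.9) p.392, (3.30) p.395] -/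
theorem covCoCurlL2K_gaugeU (F : PlaqL2K ℂ d Pd c₀ W) :
    covCoCurlL2K ℂ c₀ c (adTransportW φ fun b => (gaugeU g U b)⁻¹) (gaugeW φ (fun p : B9SectCLatticeCarrier.Plaq d Pd => g p.1) F) =
      gaugeW φ (fun b : Bond d Pd => g (bpos b)) (covCoCurlL2K ℂ c₀ c (adTransportW φ fun b => (U b)⁻¹) F) := by
  apply (WL2.equiv ℂ (fun _ : Bond d Pd => c₀) W).injective
  funext b
  rw [equiv_covCoCurlL2K, equiv_gaugeW_eq, equiv_gaugeW, equiv_covCoCurlL2K]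
  exact covCoCurl_conj c _ _ (fun x => AdW φ (g x)) (fun x => AdW φ (g x)⁻¹) (fun x v => AdW_inv_apply φ (g x) v)
    (fun b v => adTransportW_gaugeU_inv φ g U b v) _ b

/-- **THE PRINCIPAL PART `D*D` OF (3.10) IS COVARIANT**: `(D*D)(U^u) R(u) = R(u) (D*D)(U)` for the chain's
`B9Eq310HessianOperator.principalOpK` — every background, every gauge function, no hypothesis. [cite: Balaban1985BackgroundPropagators, (3.10) p.392, (3.30) p.395] -/
theorem principalOpK_gaugeU (η : ℝ) (X : BondL2K ℂ d Pd c₀ W) :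
    principalOpK φ η (gaugeU g U) (gaugeW φ (fun b : Bond d Pd => g (bpos b)) X) =
      gaugeW φ (fun b : Bond d Pd => g (bpos b)) (principalOpK φ η U X) := by
  rw [B9Eq310HessianOperator.principalOpK_eq_comp, B9Eq310HessianOperator.principalOpK_eq_comp, LinearMap.comp_apply, LinearMap.comp_apply,
    covCurlL2K_gaugeU, covCoCurlL2K_gaugeU]

/-- **(3.23)/(3.31) `Δ^η_{U^u} R(u) = R(u) Δ^η_U`** for the covariant Laplacian `D*_U D_U` of the gauge parameters
(`B11Eq103H1Complex.covLaplaceSiteK` at the chain's transporters). [cite: Balaban1985BackgroundPropagators, (3.23) p.394, (3.31) p.395] -/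
theorem covLaplaceSiteK_gaugeU (f : SiteL2K ℂ d Pd c₀ W) :
    covLaplaceSiteK c (adTransportW φ (gaugeU g U)) (adTransportW φ fun b => (gaugeU g U b)⁻¹) (gaugeW φ g f) =
      gaugeW φ g (covLaplaceSiteK c (adTransportW φ U) (adTransportW φ fun b => (U b)⁻¹) f) := by
  rw [covLaplaceSiteK, covLaplaceSiteK, LinearMap.comp_apply, LinearMap.comp_apply, covDerivL2K_gaugeU, covDivL2K_gaugeU]

/-- The printed quadratic-form statement of (3.31): `⟨R(u)λ, Δ^η_{U^u}R(u)λ⟩ = ⟨λ, Δ^η_Uλ⟩` (given the fibrewise isometry `hAd`).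
[cite: Balaban1985BackgroundPropagators, (3.31) p.395] -/
theorem inner_covLaplaceSiteK_gaugeU (hAd : ∀ (x : TSite d Pd) (v v' : W), ⟪AdW φ (g x) v, AdW φ (g x) v'⟫_ℂ = ⟪v, v'⟫_ℂ)
    (f : SiteL2K ℂ d Pd c₀ W) :
    ⟪gaugeW φ g f, covLaplaceSiteK c (adTransportW φ (gaugeU g U)) (adTransportW φ fun b => (gaugeU g U b)⁻¹) (gaugeW φ g f)⟫_ℂ =
      ⟪f, covLaplaceSiteK c (adTransportW φ U) (adTransportW φ fun b => (U b)⁻¹) f⟫_ℂ := by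
  rw [covLaplaceSiteK_gaugeU, inner_gaugeW φ g hAd]

end Letters

end Literature.MathematicalPhysics.QuantumFieldTheory.Balaban1983to89.B9Eq328GaugeAction

end
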